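import Mathlib
import Summits.ValiantsHypothesis.ValiantsHypothesis.Theorems.BinomialElusiveBinomialCandidateCrossCapEliminant

/-!
# Crux `BinomialElusive.BinomialCandidate` (stmt-ValiantsHypothesis-7392), line `registered`,
# skeleton v6 — helper `weightedNorm_order_four` (piece G of `stub_nondegenerateCorankTwo`)

A self-contained computation in `ℂ⟦X₁⟧⟦X₂⟧ = PowerSeries (PowerSeries ℂ)` (outer variable
`X₂ = PowerSeries.X`, inner variable `X₁`; `coeff i (coeff j F)` is the coefficient of the monomial
`X₁^i X₂^j`, of *weight* `i + j`).  Suppose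

* `fu = X₂² + (weight ≥ 3)` and `fv = X₁² + (weight ≥ 3)` (all coefficients of weight `≤ 1`
  vanish and the weight-two coefficients are the displayed ones),
* `fv = Q₀ fu + (C r₀₀ + C r₁₀ X₂)` and `X₂ fv = Q₁ fu + (C r₀₁ + C r₁₁ X₂)` for arbitrary
  `Q₀, Q₁ ∈ ℂ⟦X₁⟧⟦X₂⟧` and `r₀₀, r₁₀, r₀₁, r₁₁ ∈ ℂ⟦X₁⟧` (e.g. the two Weierstrass divisions by
  `fu`).

Then the determinant `r₀₀ r₁₁ - r₁₀ r₀₁` equals `X₁⁴ + O(X₁⁵)`: its coefficients of index `< 4`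
vanish and its `X₁⁴`-coefficient is `1`.

Proof: compare the coefficients of twelve monomials of weight `≤ 3` in the two identities (no
uniqueness of Weierstrass division is needed).  In the first identity the monomials `1, X₁, X₁²`
give `r₀₀ = X₁² + O(X₁³)` and the monomials `X₂, X₁X₂` give `r₁₀ = O(X₁²)`.  In the second identity
`1, X₁, X₁²` give `r₀₁ = O(X₁³)`, `X₂, X₁X₂` give `r₁₁ = O(X₁²)`, the monomial `X₂²` gives
`Q₁(0, 0) = 0`, and then the monomial `X₁²X₂` gives `coeff 2 r₁₁ = 1`.  Finally the
`X₁ⁿ`-coefficients (`n ≤ 4`) of the determinant are read off from these eleven facts.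
Mathlib only, plus the small coefficient-of-a-product lemmas `CrossCap.coeff_zero_mul'`, … of the
cross-cap eliminant file.
-/

-- layout Summits/ValiantsHypothesis/ValiantsHypothesis forces the duplicated namespace component
set_option linter.dupNamespace false

namespace Summit.ValiantsHypothesis.ValiantsHypothesis.Theorems.BinomialCandidateStubs

open scoped BigOperators

namespace CorankTwoWeightedNorm

open CrossCap

section CoeffLemmas

variable {A : Type*} [CommSemiring A]

/-- `X⁴`-coefficient of a product of power series. -/
theorem coeff_four_mul' (φ ψ : PowerSeries A) :
    PowerSeries.coeff 4 (φ * ψ) =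
      PowerSeries.coeff 0 φ * PowerSeries.coeff 4 ψ + PowerSeries.coeff 1 φ * PowerSeries.coeff 3 ψ +
        PowerSeries.coeff 2 φ * PowerSeries.coeff 2 ψ + PowerSeries.coeff 3 φ * PowerSeries.coeff 1 ψ +
          PowerSeries.coeff 4 φ * PowerSeries.coeff 0 ψ := by
  rw [PowerSeries.coeff_mul, Finset.Nat.sum_antidiagonal_eq_sum_range_succ_mk]
  simp [Finset.sum_range_succ]

/-- `X⁰`-coefficient of the right-hand side `Q f + (C a + C b X)` of a division identity. -/
theorem coeff_zero_divId (Q f : PowerSeries A) (a b : A) :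
    PowerSeries.coeff 0 (Q * f + (PowerSeries.C a + PowerSeries.C b * PowerSeries.X)) =
      PowerSeries.coeff 0 Q * PowerSeries.coeff 0 f + a := by
  simp

/-- `X¹`-coefficient of the right-hand side `Q f + (C a + C b X)` of a division identity. -/
theorem coeff_one_divId (Q f : PowerSeries A) (a b : A) :
    PowerSeries.coeff 1 (Q * f + (PowerSeries.C a + PowerSeries.C b * PowerSeries.X)) =
      PowerSeries.coeff 0 Q * PowerSeries.coeff 1 f + PowerSeries.coeff 1 Q * PowerSeries.coeff 0 f +
        b := by
  simp [coeff_one_mul', PowerSeries.coeff_C]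

/-- `X²`-coefficient of the right-hand side `Q f + (C a + C b X)` of a division identity. -/
theorem coeff_two_divId (Q f : PowerSeries A) (a b : A) :
    PowerSeries.coeff 2 (Q * f + (PowerSeries.C a + PowerSeries.C b * PowerSeries.X)) =
      PowerSeries.coeff 0 Q * PowerSeries.coeff 2 f + PowerSeries.coeff 1 Q * PowerSeries.coeff 1 f +
        PowerSeries.coeff 2 Q * PowerSeries.coeff 0 f := by
  simp [coeff_two_mul']

end CoeffLemmas

/-- The determinant `r₀₀ r₁₁ - r₁₀ r₀₁` is `X⁴ + O(X⁵)` as soon as `r₀₀ = X² + O(X³)`,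
`r₁₁ = X² + O(X³)`, `r₁₀ = O(X²)` and `r₀₁ = O(X³)`. -/
theorem det_order_four (r₀₀ r₁₀ r₀₁ r₁₁ : PowerSeries ℂ)
    (a0 : PowerSeries.coeff 0 r₀₀ = 0) (a1 : PowerSeries.coeff 1 r₀₀ = 0)
    (a2 : PowerSeries.coeff 2 r₀₀ = 1)
    (b0 : PowerSeries.coeff 0 r₁₀ = 0) (b1 : PowerSeries.coeff 1 r₁₀ = 0)
    (c0 : PowerSeries.coeff 0 r₀₁ = 0) (c1 : PowerSeries.coeff 1 r₀₁ = 0)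
    (c2 : PowerSeries.coeff 2 r₀₁ = 0)
    (d0 : PowerSeries.coeff 0 r₁₁ = 0) (d1 : PowerSeries.coeff 1 r₁₁ = 0)
    (d2 : PowerSeries.coeff 2 r₁₁ = 1) :
    (∀ n < 4, PowerSeries.coeff n (r₀₀ * r₁₁ - r₁₀ * r₀₁) = 0) ∧
      PowerSeries.coeff 4 (r₀₀ * r₁₁ - r₁₀ * r₀₁) = 1 := by
  refine ⟨fun n hn => ?_, ?_⟩
  · interval_cases n
    · rw [map_sub, CrossCap.coeff_zero_mul', CrossCap.coeff_zero_mul', a0, b0]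
      ring
    · rw [map_sub, CrossCap.coeff_one_mul', CrossCap.coeff_one_mul', a0, a1, b0, b1]
      ring
    · rw [map_sub, CrossCap.coeff_two_mul', CrossCap.coeff_two_mul', a0, a1, d0, b0, b1, c0]
      ring
    · rw [map_sub, CrossCap.coeff_three_mul', CrossCap.coeff_three_mul', a0, a1, d0, d1, b0, b1,
        c0, c1]
      ring
  · rw [map_sub, coeff_four_mul', coeff_four_mul', a0, a1, a2, d0, d1, d2, b0, b1, c0, c1, c2]
    ring

end CorankTwoWeightedNorm

open CrossCap CorankTwoWeightedNorm in
/-- **Piece G of `stub_nondegenerateCorankTwo`: the weighted norm has `X₁`-order four.**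
In `ℂ⟦X₁⟧⟦X₂⟧ = PowerSeries (PowerSeries ℂ)` let `fu = X₂² + (weight ≥ 3)` and
`fv = X₁² + (weight ≥ 3)`, and let `fv = Q₀ fu + (C r₀₀ + C r₁₀ X₂)`,
`X₂ fv = Q₁ fu + (C r₀₁ + C r₁₁ X₂)` with arbitrary `Q₀, Q₁` and `r's ∈ ℂ⟦X₁⟧`.  Then
`r₀₀ r₁₁ - r₁₀ r₀₁ = X₁⁴ + O(X₁⁵)`. -/
theorem weightedNorm_order_four :
    ∀ (fu fv Q₀ Q₁ : PowerSeries (PowerSeries ℂ)) (r₀₀ r₁₀ r₀₁ r₁₁ : PowerSeries ℂ),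
      (∀ i j : ℕ, i + j ≤ 1 → PowerSeries.coeff i (PowerSeries.coeff j fu) = 0) →
      PowerSeries.coeff 0 (PowerSeries.coeff 2 fu) = 1 →
      PowerSeries.coeff 1 (PowerSeries.coeff 1 fu) = 0 →
      PowerSeries.coeff 2 (PowerSeries.coeff 0 fu) = 0 →
      (∀ i j : ℕ, i + j ≤ 1 → PowerSeries.coeff i (PowerSeries.coeff j fv) = 0) →
      PowerSeries.coeff 0 (PowerSeries.coeff 2 fv) = 0 →
      PowerSeries.coeff 1 (PowerSeries.coeff 1 fv) = 0 →
      PowerSeries.coeff 2 (PowerSeries.coeff 0 fv) = 1 →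
      fv = Q₀ * fu + (PowerSeries.C r₀₀ + PowerSeries.C r₁₀ * PowerSeries.X) →
      PowerSeries.X * fv = Q₁ * fu + (PowerSeries.C r₀₁ + PowerSeries.C r₁₁ * PowerSeries.X) →
      (∀ n < 4, PowerSeries.coeff n (r₀₀ * r₁₁ - r₁₀ * r₀₁) = 0) ∧
        PowerSeries.coeff 4 (r₀₀ * r₁₁ - r₁₀ * r₀₁) = 1 := by
  intro fu fv Q₀ Q₁ r₀₀ r₁₀ r₀₁ r₁₁ hu hu02 hu11 hu20 hv _hv02 hv11 hv20 h1 h2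
  -- the vanishing coefficients of weight `≤ 1`
  have hu00 : PowerSeries.coeff 0 (PowerSeries.coeff 0 fu) = 0 := hu 0 0 (by norm_num)
  have hu10 : PowerSeries.coeff 1 (PowerSeries.coeff 0 fu) = 0 := hu 1 0 (by norm_num)
  have hu01 : PowerSeries.coeff 0 (PowerSeries.coeff 1 fu) = 0 := hu 0 1 (by norm_num)
  have hv00 : PowerSeries.coeff 0 (PowerSeries.coeff 0 fv) = 0 := hv 0 0 (by norm_num)
  have hv10 : PowerSeries.coeff 1 (PowerSeries.coeff 0 fv) = 0 := hv 1 0 (by norm_num)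
  have hv01 : PowerSeries.coeff 0 (PowerSeries.coeff 1 fv) = 0 := hv 0 1 (by norm_num)
  -- the five outer (`X₂`-) coefficient identities
  have E1_0 := congrArg (PowerSeries.coeff 0) h1
  have E1_1 := congrArg (PowerSeries.coeff 1) h1
  have E2_0 := congrArg (PowerSeries.coeff 0) h2
  have E2_1 := congrArg (PowerSeries.coeff 1) h2
  have E2_2 := congrArg (PowerSeries.coeff 2) h2
  rw [coeff_zero_divId] at E1_0
  rw [coeff_one_divId] at E1_1
  rw [PowerSeries.coeff_zero_X_mul, coeff_zero_divId] at E2_0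
  rw [coeff_one_X_mul', coeff_one_divId] at E2_1
  rw [coeff_two_X_mul', coeff_two_divId] at E2_2
  -- identity 1, monomials `1, X₁, X₁²`
  have a0 : PowerSeries.coeff 0 r₀₀ = 0 := by
    have := congrArg (PowerSeries.coeff 0) E1_0
    simp only [map_add, coeff_zero_mul', hv00, hu00, mul_zero, zero_add] at this
    exact this.symm
  have a1 : PowerSeries.coeff 1 r₀₀ = 0 := by
    have := congrArg (PowerSeries.coeff 1) E1_0
    simp only [map_add, coeff_one_mul', hv10, hu00, hu10, mul_zero, zero_add] at this
    exact this.symm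
  have a2 : PowerSeries.coeff 2 r₀₀ = 1 := by
    have := congrArg (PowerSeries.coeff 2) E1_0
    simp only [map_add, coeff_two_mul', hv20, hu00, hu10, hu20, mul_zero, zero_add] at this
    exact this.symm
  -- identity 1, monomials `X₂, X₁X₂`
  have b0 : PowerSeries.coeff 0 r₁₀ = 0 := by
    have := congrArg (PowerSeries.coeff 0) E1_1
    simp only [map_add, coeff_zero_mul', hv01, hu01, hu00, mul_zero, zero_add] at this
    exact this.symm
  have b1 : PowerSeries.coeff 1 r₁₀ = 0 := by
    have := congrArg (PowerSeries.coeff 1) E1_1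
    simp only [map_add, coeff_one_mul', hv11, hu01, hu11, hu00, hu10, mul_zero, zero_add] at this
    exact this.symm
  -- identity 2, monomials `1, X₁, X₁²`
  have c0 : PowerSeries.coeff 0 r₀₁ = 0 := by
    have := congrArg (PowerSeries.coeff 0) E2_0
    simp only [map_zero, map_add, coeff_zero_mul', hu00, mul_zero, zero_add] at this
    exact this.symm
  have c1 : PowerSeries.coeff 1 r₀₁ = 0 := by
    have := congrArg (PowerSeries.coeff 1) E2_0
    simp only [map_zero, map_add, coeff_one_mul', hu00, hu10, mul_zero, zero_add] at this
    exact this.symm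
  have c2 : PowerSeries.coeff 2 r₀₁ = 0 := by
    have := congrArg (PowerSeries.coeff 2) E2_0
    simp only [map_zero, map_add, coeff_two_mul', hu00, hu10, hu20, mul_zero, zero_add] at this
    exact this.symm
  -- identity 2, monomials `X₂, X₁X₂`
  have d0 : PowerSeries.coeff 0 r₁₁ = 0 := by
    have := congrArg (PowerSeries.coeff 0) E2_1
    simp only [map_add, coeff_zero_mul', hv00, hu01, hu00, mul_zero, zero_add] at this
    exact this.symm
  have d1 : PowerSeries.coeff 1 r₁₁ = 0 := by
    have := congrArg (PowerSeries.coeff 1) E2_1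
    simp only [map_add, coeff_one_mul', hv10, hu01, hu11, hu00, hu10, mul_zero, zero_add] at this
    exact this.symm
  -- identity 2, monomial `X₂²`: the constant coefficient of `Q₁` vanishes
  have q00 : PowerSeries.coeff 0 (PowerSeries.coeff 0 Q₁) = 0 := by
    have := congrArg (PowerSeries.coeff 0) E2_2
    simp only [map_add, coeff_zero_mul', hv01, hu02, hu01, hu00, mul_one, mul_zero, add_zero] at this
    exact this.symm
  -- identity 2, monomial `X₁²X₂`
  have d2 : PowerSeries.coeff 2 r₁₁ = 1 := by
    have := congrArg (PowerSeries.coeff 2) E2_1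
    simp only [map_add, coeff_two_mul', hv20, q00, hu01, hu11, hu00, hu10, hu20, zero_mul, mul_zero,
      zero_add] at this
    exact this.symm
  exact det_order_four r₀₀ r₁₀ r₀₁ r₁₁ a0 a1 a2 b0 b1 c0 c1 c2 d0 d1 d2

end Summit.ValiantsHypothesis.ValiantsHypothesis.Theorems.BinomialCandidateStubs
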